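import Mathlib
import Summits.Ventures.FusionMHD.Models.CerfonFreidbergIterLikeQHalfResDefs
import HarnessLib

/-!
# Ventures/FusionMHD — Models/CerfonFreidbergIterLikeQHalfResPanels17.lean: KERNEL CHECK of the resistive-register certificates of panel(s) 29 (of 32)
# at `ψ_N = 1/2` of THE Cerfon–Freidberg ITER-like instance

HONEST FRAMING (LADDER-GRIDFUSION three columns; CF rung; rider «D_R at ψ_N = 1/2»).  One `decide +kernel` (≈ 60–90 s): for each listed panel the obligation
`CFIterLike.QHalfRes.ResCert.ok` (`Models/CerfonFreidbergIterLikeQHalfResDefs.lean`) — the Taylor-model run of `progR = progM ++ block3R` over ★ #117's parameter box is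
ACCEPTED and the kernel's two panel-integral enclosures (`g_AG`, `g_W` along the approximant) lie inside the claimed integers (compiled `#eval` of the same functions, slack
one unit of `2⁻⁶⁰`; float truth inside every panel, `genqm/truthR.json`).  MODELLED: analytic Cerfon–Freidberg family; nothing about a device or stability.
No `native_decide`.  Typer/prover: gridfusion-model-7 (g7), 2026-08-28.  Citations: Zheng 2015 §3.2 (3.42) [Zheng2015];
Mahboubi–Melquiond–Sibut-Pinote 2016 §3.2 Lemma 3 [MahboubiMelquiondSibutpinote2016].
-/

namespace Summit.Ventures.FusionMHD.Models.CFIterLike.QHalfRes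

/-- Resistive-register certificate data of panel(s) 29. [instance data] -/
def resCert17 : List ResCert := [
  { j := 29, cand1 := [808803980806591217664, -1579000273804849053696, 11655181543848680620032, -20518749518506296868864, 76090462518139823325184, -69460346233848493768704, 6134524796326230622208, 1175683450772987995750400, -6008666594762863337799680, 27803208632627485760028672, 1463971945838785314204680192, -9621375309758409835429232640, -1938039127481739854782440407040],
    cand2 := [630029804026069778432, -757288795397705433088, 5598468336498108268544, -10245996920259378937856, 43135501895526365790208, -86470466620183216652288, 260753330855466158260224, -436750636805581705314304, 562434406373851979055104, 7494529857321790729093120, 677518485461196855150903296, -11492335641458125728122929152, -904479907832243691774590058496],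
    deg := 12, e1 := 43, e2 := 43, glo := 4693917645504704, ghi := 4693917799416509, wlo := 173922663744775174, whi := 173922668904080137 }]

/-- **KERNEL CHECK** of the two resistive registers on panel(s) 29. -/
theorem resCert17_ok : CFIterLike.QHalfRes.resCert17.all ResCert.ok = true := by
  decide +kernel

end Summit.Ventures.FusionMHD.Models.CFIterLike.QHalfRes
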